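import Literature.NumberTheory.LFunctions.ChebyshevCostaPereira68Scheme
import HarnessLib

/-!
# A Costa Pereira-type `m = 68` Chebyshev scheme, part 2/4: kernel chunks 3–6 of the pointwise comparison

Topic `Literature/NumberTheory/LFunctions`; namespace `Literature.NumberTheory.LFunctions.CostaPereira68`.  Pure proof file (kernel computation,
nothing asserted, no definition): `chkAll_3` … `chkAll_6` — the pointwise check `F r ≤ w_L r ∧ w_U r ≤ F r`
(`Literature.NumberTheory.LFunctions.CostaPereira68.chk`, part 1) on `r ∈ [9001, 21001)`, by `decide +kernel`
(about a minute of kernel time each).  Method: Costa Pereira, Acta Arith. 52 (1989), §2 (2.11)–(2.14)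
[CostaPereira1989]; design and certificate: cell `parity-ideate` p5 ROUND-44 (port, verbatim).

## References
* N. Costa Pereira, Acta Arith. 52 (1989), 307–337, §2 (2.11)–(2.14). [CostaPereira1989]
-/

namespace Literature.NumberTheory.LFunctions.CostaPereira68

/-- Kernel certificate chunk 3: `chk` holds for `3000` consecutive arguments from `9001`. [cite: CostaPereira1989, (2.11)–(2.12) (pointwise comparison of `F` with the block weights; kernel certificate of this file's design)] -/
theorem chkAll_3 : chkAll 9001 3000 = true := by decide +kernel

/-- Kernel certificate chunk 4: `chk` holds for `3000` consecutive arguments from `12001`. [cite: CostaPereira1989, (2.11)–(2.12) (pointwise comparison of `F` with the block weights; kernel certificate of this file's design)] -/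
theorem chkAll_4 : chkAll 12001 3000 = true := by decide +kernel

/-- Kernel certificate chunk 5: `chk` holds for `3000` consecutive arguments from `15001`. [cite: CostaPereira1989, (2.11)–(2.12) (pointwise comparison of `F` with the block weights; kernel certificate of this file's design)] -/
theorem chkAll_5 : chkAll 15001 3000 = true := by decide +kernel

/-- Kernel certificate chunk 6: `chk` holds for `3000` consecutive arguments from `18001`. [cite: CostaPereira1989, (2.11)–(2.12) (pointwise comparison of `F` with the block weights; kernel certificate of this file's design)] -/
theorem chkAll_6 : chkAll 18001 3000 = true := by decide +kernel

end Literature.NumberTheory.LFunctions.CostaPereira68
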